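import Summits.KontsevichZagierPeriods.KontsevichZagierPeriods.Theorems.LinRedNormalFormArrangementNormalFormStubRebaseSimpleZeroManyChainPinchU
import Summits.KontsevichZagierPeriods.KontsevichZagierPeriods.Theorems.LinRedNormalFormArrangementNormalFormStubRebaseSimpleZeroManyChainGrid

/-!
# Stub `stub_rebaseSimpleZeroMany`, part `rebaseSimpleZeroMany_common` (crux `ArrangementNormalForm`,
line `janus-bands`) — brick `ChainPinch`

The PINCH END of a clean chain `A(y) < t₀ < ⋯ < tₙ < B(y)` of `n + 1` fibres (constant letters,
simple base pole) over a one-dimensional base: the bounds meet at the vertex `(y₀, t₀)`. For each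
side `ε₁ = ±1` an explicit rational `ε > 0` is produced (`RebaseChain.pinch_side`), depending
only on the data, such that the piece over `cell M₀ ∩ {0 < ε₁ (y − y₀) < ε}` is good for
`GG 0 2 (n + 1)` (the `K`-fibre version of brick `NestedPinch`):
* `ε` is below the gaps of the rows of `M₀` at `y₀` (`RebaseNest.rows_near`: the piece's cell is
  then empty or exactly the interval), below half the distance to the base pole, and so small
  that `B` stays below the letters above `t₀`;
* by the signs of the opening slopes `ε₁ A' ≤ ε₁ B'`: empty fibres / separable by `κ = t₀`
  (`IsChain.good_sep`) / opening upwards (`RebaseChain.exists_eps_U`: the three sub-cases of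
  brick `ChainPinchU`) / opening downwards (reflection `IsChain.reflect`, then upwards).
The target is ENLARGED by the mixed blow-up configurations themselves: `RebaseChain.mixedSet n`
(literal two-row cell, bounds through the vertex opening strictly upwards, base pole at the pinch
abscissa, a letter at the vertex level and a letter elsewhere) and
`RebaseChain.GoodM n x := ∃ c ∈ closure (GG 0 2 (n + 1) ∪ mixedSet n), x − c ∈ KZ.relations`, so
that the dissection is UNCONDITIONAL; under the hypothesis `RebaseChain.PinchMixed n` (every mixed
configuration is good) `GoodM` collapses to `Good` (`RebaseChain.good_of_goodM`).
Registered: `rebaseSimpleZeroMany_chainPinchSide`.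

References: M. Kontsevich, D. Zagier, *Periods* (2001), §1.2, rules (1a), (2).
-/

noncomputable section

open Set MeasureTheory MvPolynomial
open Literature.NumberTheory.Transcendental Literature.ModelTheory.ExponentialFields

namespace Summit.KontsevichZagierPeriods.ArrangementNormalForm.JanusBands

namespace RebaseChain

open SeparatePos RebasePos RebaseZero RebaseNest

variable {n m₀ : ℕ} {A Bd : Cf} {T : BData} {a : Fin (n + 1) → Option Cf} {y₀ t₀ ε₁ : ℚ}

/-! ### The enlarged target -/

/-- **The mixed pinch configurations** as formal representations: clean chains of `n + 1` fibres
over the literal two-row cell `{0 < ε₁ (y − y₀) < ε}` whose bounds pass through `(y₀, t₀)` and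
open strictly upwards, simple base pole AT `y₀`, constant letters with one at the vertex level
`t₀` and one at another level. [Kontsevich–Zagier 2001, §1.2] -/
def mixedSet (n : ℕ) : Set KZ.FormalRep :=
  {w | ∃ (s : KZ.IntegralRep (0 + 1 + (n + 1))) (A Bd : Cf) (T : BData) (p : MvPolynomial (Fin 0) ℚ)
    (a : Fin (n + 1) → Option Cf) (y₀ t₀ ε₁ ε : ℚ),
    IsChain s ![RebaseZero.mk ε₁ (-(ε₁ * y₀)), RebaseZero.mk (-ε₁) (ε₁ * y₀ + ε)] A Bd T p a ∧
    (ε₁ = 1 ∨ ε₁ = -1) ∧ 0 < ε ∧ A.1 (Fin.last 0) * y₀ + A.2 = t₀ ∧ Bd.1 (Fin.last 0) * y₀ + Bd.2 = t₀ ∧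
    0 < ε₁ * A.1 (Fin.last 0) ∧ ε₁ * A.1 (Fin.last 0) < ε₁ * Bd.1 (Fin.last 0) ∧ T.ℓ₂.2 = y₀ ∧
    (∃ l c, a l = some c ∧ c.2 = t₀) ∧ (∃ l c, a l = some c ∧ c.2 ≠ t₀) ∧ w = KZ.of s}

/-- `GOOD MODULO THE MIXED CONFIGURATIONS`: congruent modulo `KZ.relations` to the subgroup
generated by the literal class `GG 0 2 (n + 1)` and the mixed pinch configurations. [folklore] -/
def GoodM (n : ℕ) (x : KZ.FormalRep) : Prop :=
  ∃ c ∈ AddSubgroup.closure (GGset 0 2 (n + 1) ∪ mixedSet n), x - c ∈ KZ.relations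

/-- Good elements are good modulo the mixed configurations. [folklore] -/
theorem goodM_of_good {x : KZ.FormalRep} (h : Good (n + 1) x) : GoodM n x := by
  obtain ⟨c, hc, hxc⟩ := h
  exact ⟨c, AddSubgroup.closure_mono subset_union_left hc, hxc⟩

/-- Mixed configurations are good modulo the mixed configurations. [folklore] -/
theorem goodM_of_mem {x : KZ.FormalRep} (h : x ∈ mixedSet n) : GoodM n x :=
  RebaseNest.good_of_mem (Or.inr h)

/-- `GoodM` passes along relations. [folklore] -/
theorem goodM_of_sub_mem {x y : KZ.FormalRep} (h : x - y ∈ KZ.relations) (hy : GoodM n y) : GoodM n x :=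
  RebaseNest.good_of_sub_mem h hy

/-- `GoodM` from a three-term relation `[s] − [s₁] − [s₂] ∈ relations`. [folklore] -/
theorem goodM_of_rel3 {x y w : KZ.FormalRep} (h : x - y - w ∈ KZ.relations) (hy : GoodM n y)
    (hw : GoodM n w) : GoodM n x :=
  RebaseNest.good_of_sub_mem (by rwa [sub_add_eq_sub_sub]) (RebaseNest.good_add hy hw)

/-- Under the mixed pinch hypothesis the enlarged subgroup consists of good elements. -/
theorem good_of_mem_closure (hB : PinchMixed n) {c : KZ.FormalRep}
    (hc : c ∈ AddSubgroup.closure (GGset 0 2 (n + 1) ∪ mixedSet n)) : Good (n + 1) c := by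
  induction hc using AddSubgroup.closure_induction with
  | mem y hy =>
    rcases hy with hy | hy
    · exact RebaseZero.good_of_mem hy
    · obtain ⟨s, A, Bd, T, p, a, y₀, t₀, ε₁, ε, hN, hε₁, hε, hA0, hB0, hα, hαβ, hp, hat, hne, rfl⟩ := hy
      exact hB 2 s _ A Bd T p a y₀ t₀ ε₁ ε hN hε₁ hε (fun y => mem_cell_two y₀ ε ε₁ y) hA0 hB0 hα hαβ hp
        hat hne
  | zero => exact RebaseZero.good_of_mem_relations (zero_mem _)
  | add x y _ _ hx hy => exact hx.add hy
  | neg x _ hx =>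
    obtain ⟨c, hc, hxc⟩ := hx
    refine ⟨-c, neg_mem hc, ?_⟩
    have := KZ.relations.neg_mem hxc
    rwa [show -(x - c) = -x - -c by abel] at this

/-- **Under the mixed pinch hypothesis `GoodM` is `Good`.** -/
theorem good_of_goodM (hB : PinchMixed n) {x : KZ.FormalRep} (h : GoodM n x) : Good (n + 1) x := by
  obtain ⟨c, hc, hxc⟩ := h
  exact RebaseZero.good_of_sub_mem hxc (good_of_mem_closure hB hc)

variable {m' : ℕ} {M : Fin m' → Cf} {s : KZ.IntegralRep (0 + 1 + (n + 1))} {p : MvPolynomial (Fin 0) ℚ} in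
/-- **Cutting the base cell at a rational form** (rule 1a), `GoodM` version of
`IsChain.rowSplit`. -/
theorem IsChain.rowSplitM (h : IsChain s M A Bd T p a) (q : Cf) (hq : q ≠ 0)
    (h₁ : ∀ s₁ : KZ.IntegralRep (0 + 1 + (n + 1)),
      IsChain s₁ (Fin.snoc M q : Fin (m' + 1) → Cf) A Bd T p a → GoodM n (KZ.of s₁))
    (h₂ : ∀ s₂ : KZ.IntegralRep (0 + 1 + (n + 1)),
      IsChain s₂ (Fin.snoc M (-q) : Fin (m' + 1) → Cf) A Bd T p a → GoodM n (KZ.of s₂)) :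
    GoodM n (KZ.of s) := by
  obtain ⟨s₁, s₂, hm₁, hm₂, hi₁, hi₂, hd₁, hd₂, hrel⟩ := cutBase s M (clo A) (chi Bd) h.dom q hq
  have hs₁ : s₁.domain ⊆ s.domain := fun z hz => ((hm₁ z).1 hz).1
  have hs₂ : s₂.domain ⊆ s.domain := fun z hz => ((hm₂ z).1 hz).1
  refine goodM_of_rel3 hrel (h₁ s₁ ⟨hd₁, fun z hz => ?_, h.n1, h.n2, h.a0, h.bdd.subset hs₁⟩)
    (h₂ s₂ ⟨hd₂, fun z hz => ?_, h.n1, h.n2, h.a0, h.bdd.subset hs₂⟩)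
  · rw [hi₁]; exact h.int (hs₁ hz)
  · rw [hi₂]; exact h.int (hs₂ hz)

/-- A clean chain over a cell which is exactly `{0 < ε₁ (y − y₀) < ε}` is a clean chain over the
literal two-row cell. [folklore] -/
theorem IsChain.two_rows {m' : ℕ} {M : Fin m' → Cf} {s : KZ.IntegralRep (0 + 1 + (n + 1))}
    {p : MvPolynomial (Fin 0) ℚ} (h : IsChain s M A Bd T p a) {ε : ℚ}
    (hcellI : ∀ y : ℝ, y ∈ cell M ↔ (0 < (ε₁ : ℝ) * (y - y₀) ∧ (ε₁ : ℝ) * (y - y₀) < ε)) :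
    IsChain s ![RebaseZero.mk ε₁ (-(ε₁ * y₀)), RebaseZero.mk (-ε₁) (ε₁ * y₀ + ε)] A Bd T p a := by
  refine ⟨?_, h.int, h.n1, h.n2, h.a0, h.bdd⟩
  ext z
  rw [h.mem, mem_chain, hcellI, mem_cell_two]

/-! ### The side of a pinch end -/

/-- **The upward-opening side of a pinch end** (`0 < ε₁ A' ≤ ε₁ B'`): an explicit `ε > 0` such
that the piece of the clean chain over `cell M₀ ∩ {0 < ε₁ (y − y₀) < ε}` is good (the three
sub-cases of brick `ChainPinchU`, or an empty cell). -/
theorem exists_eps_U (T : BData) (a : Fin (n + 1) → Option Cf) (hε₁ : ε₁ = 1 ∨ ε₁ = -1)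
    (hA0 : A.1 (Fin.last 0) * y₀ + A.2 = t₀) (hB0 : Bd.1 (Fin.last 0) * y₀ + Bd.2 = t₀)
    (hα : 0 < ε₁ * A.1 (Fin.last 0)) (hαβ : ε₁ * A.1 (Fin.last 0) ≤ ε₁ * Bd.1 (Fin.last 0))
    (M₀ : Fin m₀ → Cf) (r₁ : Cf) (hr₁ : ∀ y : ℝ, ev r₁ y = ε₁ * (y - y₀)) :
    ∃ ε : ℚ, 0 < ε ∧ ∀ (s : KZ.IntegralRep (0 + 1 + (n + 1))) (p : MvPolynomial (Fin 0) ℚ),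
      IsChain s (Fin.snoc (Fin.snoc M₀ r₁ : Fin (m₀ + 1) → Cf) (RebaseZero.mk (-ε₁) (ε₁ * y₀ + ε)) :
        Fin (m₀ + 2) → Cf) A Bd T p a → GoodM n (KZ.of s) := by
  classical
  set β' : ℚ := ε₁ * Bd.1 (Fin.last 0) with hβ'
  have hβ : 0 < β' := hα.trans_le hαβ
  -- room above `t₀` below the letters above `t₀`
  obtain ⟨θ, hθ, hθle⟩ := exists_pos_le_forall
    (fun l => (a l).elim 1 fun c => if t₀ < c.2 then (c.2 - t₀) / 2 else 1) fun l => by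
      rcases a l with _ | c
      · exact one_pos
      · simp only [Option.elim_some]
        split_ifs with h
        · linarith
        · exact one_pos
  have hθ2 : ∀ l c, a l = some c → t₀ < c.2 → 2 * θ ≤ c.2 - t₀ := fun l c hc hlt => by
    have := hθle l
    simp only [hc, Option.elim_some, if_pos hlt] at this
    linarith
  -- distance of the letters below `t₀`
  obtain ⟨η₀, hη₀, hη₀le⟩ := exists_pos_le_forall
    (fun l => (a l).elim 1 fun c => if c.2 < t₀ then t₀ - c.2 else 1) fun l => by
      rcases a l with _ | c
      · exact one_pos
      · simp only [Option.elim_some]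
        split_ifs with h
        · linarith
        · exact one_pos
  have hηb : ∀ l c, a l = some c → c.2 < t₀ → η₀ ≤ t₀ - c.2 := fun l c hc hlt => by
    have := hη₀le l
    simp only [hc, Option.elim_some, if_pos hlt] at this
    exact this
  set η : ℚ := min θ η₀ with hηdef
  have hη : 0 < η := lt_min hθ hη₀
  set Tc : ℚ := t₀ + θ with hTc
  have hfar : ∀ l c, a l = some c → c.2 ≠ t₀ → ∀ t : ℝ, (t₀ : ℝ) < t → t < Tc → (η : ℝ) ≤ |t - c.2| := by
    intro l c hc hne t ht1 ht2
    rw [hTc, Rat.cast_add] at ht2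
    rcases lt_or_gt_of_ne hne with hlt | hgt
    · have h1 : ((min θ η₀ : ℚ) : ℝ) ≤ η₀ := by exact_mod_cast min_le_right θ η₀
      have h2 : (η₀ : ℝ) ≤ t₀ - c.2 := by exact_mod_cast hηb l c hc hlt
      have h3 : (c.2 : ℝ) < t₀ := by exact_mod_cast hlt
      rw [abs_of_pos (by linarith)]
      linarith
    · have h1 : ((min θ η₀ : ℚ) : ℝ) ≤ θ := by exact_mod_cast min_le_left θ η₀
      have h2 : 2 * (θ : ℝ) ≤ c.2 - t₀ := by exact_mod_cast hθ2 l c hc hgt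
      have h3 : (t₀ : ℝ) < c.2 := by exact_mod_cast hgt
      rw [abs_of_neg (by linarith)]
      linarith
  -- the base pole
  set ρ : ℚ := T.ℓ₂.2 with hρ
  set εp : ℚ := if ρ = y₀ then 1 else |ρ - y₀| / 2 with hεp
  have hεp0 : 0 < εp := by
    rw [hεp]; split_ifs with h
    · exact one_pos
    · exact div_pos (abs_pos.2 (sub_ne_zero.2 h)) two_pos
  -- the rows
  obtain ⟨εr, hεr, hrows⟩ := rows_near M₀ y₀ ε₁ hε₁
  -- the cap
  set ε : ℚ := min (min εr εp) (θ / β') with hεdef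
  have hε : 0 < ε := lt_min (lt_min hεr hεp0) (div_pos hθ hβ)
  have hεr' : ε ≤ εr := (min_le_left _ _).trans (min_le_left _ _)
  have hεp' : ε ≤ εp := (min_le_left _ _).trans (min_le_right _ _)
  have hεθ : β' * ε ≤ θ := by
    have : ε ≤ θ / β' := min_le_right _ _
    rwa [le_div_iff₀ hβ, mul_comm] at this
  refine ⟨ε, hε, fun s p hN => ?_⟩
  have hcell : ∀ y ∈ cell (Fin.snoc (Fin.snoc M₀ r₁ : Fin (m₀ + 1) → Cf) (RebaseZero.mk (-ε₁) (ε₁ * y₀ + ε)) :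
      Fin (m₀ + 2) → Cf), 0 < (ε₁ : ℝ) * (y - y₀) ∧ (ε₁ : ℝ) * (y - y₀) < ε := fun y hy => by
    rw [mem_cell_piece M₀ hr₁] at hy
    exact hy.2
  rcases hrows with hin | hout
  swap
  · -- the cell of the piece is empty
    refine goodM_of_good (hN.good_cell_empty fun y hy => ?_)
    rw [mem_cell_piece M₀ hr₁] at hy
    obtain ⟨hy, h1, h2⟩ := hy
    have : (ε : ℝ) ≤ εr := by exact_mod_cast hεr'
    exact hout y h1 (by linarith) hy
  -- the cell of the piece is exactly the interval
  have hcellI : ∀ y : ℝ, y ∈ cell (Fin.snoc (Fin.snoc M₀ r₁ : Fin (m₀ + 1) → Cf)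
      (RebaseZero.mk (-ε₁) (ε₁ * y₀ + ε)) : Fin (m₀ + 2) → Cf) ↔
      (0 < (ε₁ : ℝ) * (y - y₀) ∧ (ε₁ : ℝ) * (y - y₀) < ε) := fun y => by
    rw [mem_cell_piece M₀ hr₁]
    refine ⟨fun h => h.2, fun h => ⟨hin y h.1 ?_, h⟩⟩
    have : (ε : ℝ) ≤ εr := by exact_mod_cast hεr'
    linarith [h.2]
  -- the bounds on the piece
  have key : ∀ y : ℝ, 0 < (ε₁ : ℝ) * (y - y₀) → (ε₁ : ℝ) * (y - y₀) < ε →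
      ev Bd y < Tc ∧ |y - y₀| < ε := fun y h1 h2 => by
    obtain ⟨eB, habs⟩ := ev_vertex hε₁ hB0 h1
    have hβε : (ε₁ : ℝ) * Bd.1 (Fin.last 0) * ε ≤ θ := by
      have := hεθ; rw [hβ'] at this; exact_mod_cast this
    have hβ0 : (0 : ℝ) < ε₁ * Bd.1 (Fin.last 0) := by have := hβ; rw [hβ'] at this; exact_mod_cast this
    rw [habs] at eB ⊢
    rw [eB, hTc, Rat.cast_add]
    exact ⟨by nlinarith, h2⟩
  -- distance to the base pole
  have hpole : ρ ≠ y₀ → ∀ y : ℝ, 0 < (ε₁ : ℝ) * (y - y₀) → (ε₁ : ℝ) * (y - y₀) < ε →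
      |y - y₀| < |(ρ : ℝ) - y₀| / 2 ∧ (|(ρ : ℝ) - y₀| / 2 : ℝ) ≤ |y - ρ| := fun hne y h1 h2 => by
    have hlt := (key y h1 h2).2
    have hεd : (ε : ℝ) ≤ |(ρ : ℝ) - y₀| / 2 := by
      have := hεp'; rw [hεp, if_neg hne] at this; exact_mod_cast this
    have htri : |(ρ : ℝ) - y₀| ≤ |y - ρ| + |y - y₀| := by
      have := abs_sub_le (ρ : ℝ) y y₀
      rwa [abs_sub_comm (ρ : ℝ) y] at this
    exact ⟨by linarith, by linarith⟩
  by_cases hat : ∀ l c, a l = some c → c.2 ≠ t₀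
  · -- U1: no letter at `t₀`
    refine goodM_of_good (hN.good_pinch_free y₀ t₀ ε₁ ε η hε₁ hA0 hB0 hα hαβ hcell (fun y hy => ?_) hη
      fun l c hc y hy t ht1 ht2 => ?_)
    · obtain ⟨h1, h2⟩ := hcell y hy
      change |y - (y₀ : ℝ)| ≤ |y - ρ|
      by_cases hne : ρ = y₀
      · rw [hne]
      · obtain ⟨hl, hd⟩ := hpole hne y h1 h2
        linarith
    · obtain ⟨h1, h2⟩ := hcell y hy
      exact hfar l c hc (hat l c hc) t ht1 (ht2.trans (key y h1 h2).1)
  push Not at hat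
  obtain ⟨l₁, c₁, hc₁, hct⟩ := hat
  by_cases hρy : ρ = y₀
  · -- U3: blow-up (`Z`-chart, or a mixed configuration), or empty fibres
    rcases lt_or_eq_of_le hαβ with hlt | heq
    · by_cases hall : ∀ l c, a l = some c → c.2 = t₀
      · exact goodM_of_good (hN.good_blowZ y₀ t₀ ε₁ ε hε₁ hcellI hA0 hB0 (by rw [← hρy]) hall)
      · push Not at hall
        obtain ⟨l₂, c₂, hc₂, hne⟩ := hall
        exact goodM_of_mem ⟨s, A, Bd, T, p, a, y₀, t₀, ε₁, ε, hN.two_rows hcellI, hε₁, hε, hA0, hB0, hα, hlt,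
          by rw [← hρy], ⟨l₁, c₁, hc₁, hct⟩, ⟨l₂, c₂, hc₂, hne⟩, rfl⟩
    · refine goodM_of_good (hN.good_empty fun y hy => ?_)
      obtain ⟨h1, -⟩ := hcell y hy
      obtain ⟨eA, -⟩ := ev_vertex hε₁ hA0 h1
      obtain ⟨eB, -⟩ := ev_vertex hε₁ hB0 h1
      have : (ε₁ : ℝ) * A.1 (Fin.last 0) = ε₁ * Bd.1 (Fin.last 0) := by exact_mod_cast heq
      rw [eA, eB, this]
  · -- U2: super-section Janus
    refine goodM_of_good (hN.good_pinch_super y₀ t₀ ε₁ ε Tc η (|ρ - y₀| / 2) hε₁ hA0 hB0 hα hαβ hcell ?_ hη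
      hfar (div_pos (abs_pos.2 (sub_ne_zero.2 hρy)) two_pos) fun y hy => ?_)
    · rw [hTc, hβ'] at *
      linarith
    · obtain ⟨h1, h2⟩ := hcell y hy
      have := (hpole hρy y h1 h2).2
      change (((|ρ - y₀| / 2 : ℚ)) : ℝ) ≤ |y - ρ|
      push_cast
      exact this

/-- **One side of a pinch end.** For a clean chain whose bounds meet at the vertex `(y₀, t₀)`
there is, for each side `ε₁ = ±1`, an explicit `ε > 0` such that the piece over
`cell M₀ ∩ {0 < ε₁ (y − y₀) < ε}` is good for `GG 0 2 (n + 1)`: empty fibres, or separable by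
`t₀`, or opening upwards (`exists_eps_U`), or opening downwards (reflect the chain, then
upwards). [Kontsevich–Zagier 2001, §1.2, rules (1), (2)] -/
theorem pinch_side (T : BData) (a : Fin (n + 1) → Option Cf) (hε₁ : ε₁ = 1 ∨ ε₁ = -1)
    (hA0 : A.1 (Fin.last 0) * y₀ + A.2 = t₀) (hB0 : Bd.1 (Fin.last 0) * y₀ + Bd.2 = t₀)
    (M₀ : Fin m₀ → Cf) (r₁ : Cf) (hr₁ : ∀ y : ℝ, ev r₁ y = ε₁ * (y - y₀)) :
    ∃ ε : ℚ, 0 < ε ∧ ∀ (s : KZ.IntegralRep (0 + 1 + (n + 1))) (p : MvPolynomial (Fin 0) ℚ),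
      IsChain s (Fin.snoc (Fin.snoc M₀ r₁ : Fin (m₀ + 1) → Cf) (RebaseZero.mk (-ε₁) (ε₁ * y₀ + ε)) :
        Fin (m₀ + 2) → Cf) A Bd T p a → GoodM n (KZ.of s) := by
  set α' : ℚ := ε₁ * A.1 (Fin.last 0) with hα'
  set β' : ℚ := ε₁ * Bd.1 (Fin.last 0) with hβ'
  have hcell : ∀ (ε : ℚ), ∀ y ∈ cell (Fin.snoc (Fin.snoc M₀ r₁ : Fin (m₀ + 1) → Cf)
      (RebaseZero.mk (-ε₁) (ε₁ * y₀ + ε)) : Fin (m₀ + 2) → Cf), 0 < (ε₁ : ℝ) * (y - y₀) := fun ε y hy => by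
    rw [mem_cell_piece M₀ hr₁] at hy
    exact hy.2.1
  by_cases hβα : β' ≤ α'
  · -- empty fibres
    refine ⟨1, one_pos, fun s p hN => goodM_of_good (hN.good_empty fun y hy => ?_)⟩
    have h1 := hcell 1 y hy
    obtain ⟨eA, -⟩ := ev_vertex hε₁ hA0 h1
    obtain ⟨eB, -⟩ := ev_vertex hε₁ hB0 h1
    have : (ε₁ : ℝ) * Bd.1 (Fin.last 0) ≤ ε₁ * A.1 (Fin.last 0) := by exact_mod_cast hβα
    rw [eA, eB]
    nlinarith [abs_nonneg (y - y₀)]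
  push Not at hβα
  by_cases hαp : 0 < α'
  · -- opening upwards
    exact exists_eps_U T a hε₁ hA0 hB0 hαp hβα.le M₀ r₁ hr₁
  by_cases hβp : 0 ≤ β'
  · -- separable by `t₀`
    refine ⟨1, one_pos, fun s p hN => goodM_of_good (hN.good_sep t₀ fun y hy => ?_)⟩
    have h1 := hcell 1 y hy
    obtain ⟨eA, -⟩ := ev_vertex hε₁ hA0 h1
    obtain ⟨eB, -⟩ := ev_vertex hε₁ hB0 h1
    have hαn : (ε₁ : ℝ) * A.1 (Fin.last 0) ≤ 0 := by exact_mod_cast not_lt.1 hαp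
    have hβn : (0 : ℝ) ≤ ε₁ * Bd.1 (Fin.last 0) := by exact_mod_cast hβp
    rw [eA, eB]
    constructor <;> nlinarith [abs_nonneg (y - y₀)]
  -- opening downwards: reflect the chain
  push Not at hβp
  have hA0' : (-Bd).1 (Fin.last 0) * y₀ + (-Bd).2 = -t₀ := by rw [neg_fst, Prod.snd_neg, ← hB0]; ring
  have hB0' : (-A).1 (Fin.last 0) * y₀ + (-A).2 = -t₀ := by rw [neg_fst, Prod.snd_neg, ← hA0]; ring
  have hα2 : 0 < ε₁ * (-Bd).1 (Fin.last 0) := by rw [neg_fst, mul_neg]; linarith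
  have hαβ2 : ε₁ * (-Bd).1 (Fin.last 0) ≤ ε₁ * (-A).1 (Fin.last 0) := by
    rw [neg_fst, neg_fst, mul_neg, mul_neg]; linarith
  obtain ⟨ε, hε, hgood⟩ := exists_eps_U T (fun l => (a (Fin.rev l)).map Neg.neg) hε₁ hA0' hB0' hα2
    hαβ2 M₀ r₁ hr₁
  refine ⟨ε, hε, fun s p hN => ?_⟩
  obtain ⟨s', hN', hrel⟩ := hN.reflect
  exact goodM_of_sub_mem hrel (hgood s' _ hN')

end RebaseChain

/-- Registered support goal of this file (part of `rebaseSimpleZeroMany_common`): one side of a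
pinch end of a clean chain of `n + 1` fibres is good on an explicit short piece, given the mixed
pinch configuration (`RebaseChain.pinch_side`, `RebaseChain.good_of_goodM`). -/
theorem rebaseSimpleZeroMany_chainPinchSide (n m₀ : ℕ) (hB : RebaseChain.PinchMixed n) (A Bd : (Fin (0 + 1) → ℚ) × ℚ) (T : RebaseZero.BData) (a : Fin (n + 1) → Option ((Fin (0 + 1) → ℚ) × ℚ)) (y₀ t₀ ε₁ : ℚ) (hε₁ : ε₁ = 1 ∨ ε₁ = -1) (hA0 : A.1 (Fin.last 0) * y₀ + A.2 = t₀) (hB0 : Bd.1 (Fin.last 0) * y₀ + Bd.2 = t₀) (M₀ : Fin m₀ → (Fin (0 + 1) → ℚ) × ℚ) (r₁ : (Fin (0 + 1) → ℚ) × ℚ) (hr₁ : ∀ y : ℝ, RebaseZero.ev r₁ y = ε₁ * (y - y₀)) : ∃ ε : ℚ, 0 < ε ∧ ∀ (s : KZ.IntegralRep (0 + 1 + (n + 1))) (p : MvPolynomial (Fin 0) ℚ), RebaseChain.IsChain s (Fin.snoc (Fin.snoc M₀ r₁ : Fin (m₀ + 1) → (Fin (0 + 1) → ℚ) × ℚ)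 (RebaseZero.mk (-ε₁) (ε₁ * y₀ + ε)) : Fin (m₀ + 2) → (Fin (0 + 1) → ℚ) × ℚ) A Bd T p a → RebaseZero.Good (n + 1) (KZ.of s) :=
  let ⟨ε, hε, h⟩ := RebaseChain.pinch_side T a hε₁ hA0 hB0 M₀ r₁ hr₁
  ⟨ε, hε, fun s p hN => RebaseChain.good_of_goodM hB (h s p hN)⟩

end Summit.KontsevichZagierPeriods.ArrangementNormalForm.JanusBands
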